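import Literature.Probability.RandomPlanarGeometry.SAWReflectCuts
import HarnessLib

/-!
# Monotonicity `cₙ ≤ cₙ₊₁` (O'Brien 1990): the two length-increasing walk operations

Sibling file of `Literature.Probability.RandomPlanarGeometry.BDGS2012` (the named fact
`BDGS2012_count_mono : ∀ d n, 1 ≤ d → count d n ≤ count d (n+1)`, O'Brien 1990, quoted in
BDGS 2012 §1.3) on top of the vertex-function model `saws d n` of `SAWCount.lean`.

This file provides the two operations on `n`-step self-avoiding walks `ω` of `ℤ^d` that increase
the length by one and whose validity and effect are governed by a single coordinate `k`
("the `k`-profile" `i ↦ ω i k`):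

* `foldAt k t ω` — **fold at a maximal time**: if `ω t k = maxᵢ ω i k`, keep `ω 0, …, ω t`, make
  one step `+eₖ`, and continue with the reflection of `ω t, …, ω n` in the hyperplane
  `xₖ = ω t k + ½` (the Hammersley–Welsh reflection with one inserted step); always self-avoiding
  (`foldAt_mem_saws`), injective (`foldAt_injective`).
* `dblAt k s ω` — **doubling a cut**: if the step `s → s+1` is `+eₖ` and the hyperplane between
  `ω s` and `ω (s+1)` separates past from future (`ω i k ≤ ω s k` for `i ≤ s`, `ω i k ≥ ω s k + 1`
  for `i ≥ s+1`), insert a second `+eₖ` step and translate the future by `eₖ`; always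
  self-avoiding (`dblAt_mem_saws`), injective (`dblAt_injective`).

(The fold is the operation `reflectTail` of `SAWReflect.lean` in the function-update form used
here; this file adds the doubling of a cut, the four-operation menu `OpChoice` and the lifting
theorem `count_le_count_succ_of_selector`.) Together with `neg_mem_saws` (the walk `-ω`) these give the four profile-driven operations
(fold at a max / min time, double an up- / down-cut) from which an injection
`saws d n ↪ saws d (n+1)` is to be assembled. [cite: MadrasSlade1993, §7.1, Fig. 7.1 (the
two-step version of the fold)] [cite: BDGS2012, §1.3]
-/

noncomputable section

open Literature.Probability.LatticeModels Literature.Probability.Percolation SimpleGraph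

namespace Literature.Probability.RandomPlanarGeometry.SAW.Zd

variable {d : ℕ}

/-! ### Reflection in a coordinate hyperplane `xₖ = M + ½` -/

/-- The reflection `xₖ ↦ 2M + 1 - xₖ` (other coordinates fixed) of `ℤ^d` in the hyperplane
`xₖ = M + ½`. [cite: MadrasSlade1993, §3.1 (reflections through lattice hyperplanes)] -/
def reflK (k : Fin d) (M : ℤ) (p : Site d) : Site d :=
  Function.update p k (2 * M + 1 - p k)

/-- The reflected coordinate. [folklore] -/
@[simp] theorem reflK_apply_self (k : Fin d) (M : ℤ) (p : Site d) :
    reflK k M p k = 2 * M + 1 - p k := by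
  simp [reflK]

/-- The other coordinates are fixed. [folklore] -/
theorem reflK_apply_ne (k : Fin d) (M : ℤ) (p : Site d) {j : Fin d} (h : j ≠ k) :
    reflK k M p j = p j := by
  simp [reflK, h]

/-- The reflection is an involution. [folklore] -/
@[simp] theorem reflK_reflK (k : Fin d) (M : ℤ) (p : Site d) : reflK k M (reflK k M p) = p := by
  funext j
  by_cases h : j = k
  · subst h; simp [reflK]
  · simp [reflK, h]

/-- The reflection is injective. [folklore] -/
theorem reflK_injective (k : Fin d) (M : ℤ) : Function.Injective (reflK k M) := fun p q h => by
  simpa using congrArg (reflK k M) h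

/-- Differences under the reflection: the `k`-component changes sign. [folklore] -/
theorem reflK_sub (k : Fin d) (M : ℤ) (p q : Site d) :
    reflK k M p - reflK k M q = Function.update (p - q) k (-(p k - q k)) := by
  funext j
  by_cases h : j = k
  · subst h
    rw [Pi.sub_apply, reflK_apply_self, reflK_apply_self, Function.update_self]
    ring
  · rw [Pi.sub_apply, reflK_apply_ne _ _ _ h, reflK_apply_ne _ _ _ h, Function.update_of_ne h,
      Pi.sub_apply]

/-- The reflection is a graph automorphism of `ℤ^d`. [folklore] -/
theorem zdGraph_adj_reflK (k : Fin d) (M : ℤ) {x y : Site d} (h : (zdGraph d).Adj x y) :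
    (zdGraph d).Adj (reflK k M x) (reflK k M y) := by
  rw [zdGraph_adj_iff_sub] at h ⊢
  obtain ⟨i, hi | hi⟩ := h
  · by_cases hik : i = k
    · subst hik
      refine ⟨i, Or.inr ?_⟩
      rw [reflK_sub, ← neg_sub, hi]
      have hii := congrFun hi i
      simp only [Pi.sub_apply, Pi.single_eq_same] at hii
      funext j; by_cases hj : j = i
      · subst hj; simp; omega
      · simp [hj]
    · refine ⟨i, Or.inl ?_⟩
      rw [reflK_sub, hi]
      funext j; by_cases hj : j = k
      · subst hj
        have := congrFun hi j
        simp only [Pi.sub_apply, Pi.single_eq_of_ne (Ne.symm hik)] at this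
        simp [Pi.single_eq_of_ne (Ne.symm hik), this]
      · simp [hj]
  · by_cases hik : i = k
    · subst hik
      refine ⟨i, Or.inl ?_⟩
      rw [reflK_sub, ← neg_sub, hi]
      have hii := congrFun hi i
      simp only [Pi.sub_apply, Pi.single_eq_same] at hii
      funext j; by_cases hj : j = i
      · subst hj; simp; omega
      · simp [hj]
    · refine ⟨i, Or.inr ?_⟩
      rw [reflK_sub, hi]
      funext j; by_cases hj : j = k
      · subst hj
        have := congrFun hi j
        simp only [Pi.sub_apply, Pi.single_eq_of_ne (Ne.symm hik)] at this
        simp [Pi.single_eq_of_ne (Ne.symm hik), this]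
      · simp [hj]

/-- `p` and `p + eₖ`… more precisely: if `p k = M` then `reflK k M p = p + eₖ`. [folklore] -/
theorem reflK_of_apply_eq (k : Fin d) {M : ℤ} {p : Site d} (h : p k = M) :
    reflK k M p = p + Pi.single k 1 := by
  funext j
  by_cases hj : j = k
  · subst hj; simp [reflK, h]; ring
  · simp [reflK, hj]

/-! ### Fold at a maximal time -/

/-- **Fold at time `t`**: `ω 0, …, ω t`, then the reflections of `ω t, ω (t+1), …` in the
hyperplane `xₖ = ω t k + ½` (so the step `t → t+1` of the new walk is `+eₖ`).
[cite: MadrasSlade1993, §7.1] -/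
def foldAt (k : Fin d) (t : ℕ) (ω : ℕ → Site d) : ℕ → Site d :=
  fun i => if i ≤ t then ω i else reflK k (ω t k) (ω (i - 1))

/-- The fold keeps the walk up to the folding time. [folklore] -/
theorem foldAt_of_le {k : Fin d} {t : ℕ} {ω : ℕ → Site d} {i : ℕ} (h : i ≤ t) :
    foldAt k t ω i = ω i := if_pos h

/-- After the folding time the fold is the reflected, delayed walk. [folklore] -/
theorem foldAt_of_lt {k : Fin d} {t : ℕ} {ω : ℕ → Site d} {i : ℕ} (h : t < i) :
    foldAt k t ω i = reflK k (ω t k) (ω (i - 1)) := if_neg (not_le.2 h)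

/-- After the folding time the fold is the reflected, delayed walk. [folklore] -/
theorem foldAt_succ {k : Fin d} {t : ℕ} {ω : ℕ → Site d} {j : ℕ} (h : t ≤ j) :
    foldAt k t ω (j + 1) = reflK k (ω t k) (ω j) := by
  rw [foldAt_of_lt (Nat.lt_succ_of_le h)]; rfl

/-- The fold is injective on all vertex functions (the folding time being fixed). [folklore] -/
theorem foldAt_injective (k : Fin d) (t : ℕ) : Function.Injective (foldAt k t (d := d)) := by
  intro ω₁ ω₂ h
  have ht : ω₁ t = ω₂ t := by
    have := congrFun h t
    rwa [foldAt_of_le le_rfl, foldAt_of_le le_rfl] at this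
  funext j
  rcases Nat.lt_or_ge t j with hj | hj
  · have := congrFun h (j + 1)
    rw [foldAt_succ hj.le, foldAt_succ hj.le, ht] at this
    exact reflK_injective k _ this
  · have := congrFun h j
    rwa [foldAt_of_le hj, foldAt_of_le hj] at this

/-- **The fold of a self-avoiding walk at a maximal time is self-avoiding** (and one step
longer): the kept part lies in `xₖ ≤ M`, the reflected part in `xₖ ≥ M + 1`.
[cite: MadrasSlade1993, §7.1] -/
theorem foldAt_mem_saws {k : Fin d} {n t : ℕ} {ω : ℕ → Site d} (hω : ω ∈ saws d n) (ht : t ≤ n)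
    (hmax : ∀ i ≤ n, ω i k ≤ ω t k) : foldAt k t ω ∈ saws d (n + 1) := by
  obtain ⟨h0, hend, hadj, hinj⟩ := mem_saws.1 hω
  set M := ω t k with hM
  refine mem_saws.2 ⟨?_, ?_, ?_, ?_⟩
  · rw [foldAt_of_le (Nat.zero_le t), h0]
  · intro i hi
    have h1 : t < i := by omega
    have h2 : t < n + 1 := by omega
    rw [foldAt_of_lt h1, foldAt_of_lt h2, hend (i - 1) (by omega)]
    simp
  · intro i hi
    rcases lt_trichotomy i t with h | rfl | h
    · rw [foldAt_of_le h.le, foldAt_of_le (by omega)]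
      exact hadj i (by omega)
    · -- the inserted step `ω t → ω t + eₖ`
      rw [foldAt_of_le le_rfl, foldAt_succ le_rfl, reflK_of_apply_eq k rfl]
      exact (zdGraph_adj_iff _ _).2 ⟨k, Or.inl rfl⟩
    · rw [foldAt_of_lt h, foldAt_succ h.le]
      obtain ⟨j, rfl⟩ : ∃ j, i = j + 1 := ⟨i - 1, by omega⟩
      simp only [Nat.add_sub_cancel]
      exact zdGraph_adj_reflK k M (hadj j (by omega))
  · -- injectivity on `[0, n+1]`
    have hlow : ∀ i ≤ t, foldAt k t ω i k ≤ M := fun i hi => by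
      rw [foldAt_of_le hi]; exact hmax i (by omega)
    have hhigh : ∀ i, t < i → i ≤ n + 1 → M + 1 ≤ foldAt k t ω i k := fun i hi hin => by
      rw [foldAt_of_lt hi, reflK_apply_self]
      have := hmax (i - 1) (by omega)
      omega
    intro i hi j hj hij
    simp only [Set.mem_setOf_eq] at hi hj
    rcases Nat.lt_or_ge t i with hit | hit <;> rcases Nat.lt_or_ge t j with hjt | hjt
    · rw [foldAt_of_lt hit, foldAt_of_lt hjt] at hij
      have := hinj (by simp only [Set.mem_setOf_eq]; omega) (by simp only [Set.mem_setOf_eq]; omega)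
        (reflK_injective k M hij)
      omega
    · exfalso
      have h1 := hhigh i hit hi; have h2 := hlow j hjt
      rw [hij] at h1; omega
    · exfalso
      have h1 := hlow i hit; have h2 := hhigh j hjt hj
      rw [hij] at h1; omega
    · rw [foldAt_of_le hit, foldAt_of_le hjt] at hij
      exact hinj (by simp only [Set.mem_setOf_eq]; omega) (by simp only [Set.mem_setOf_eq]; omega) hij

/-- The `k`-profile of the fold: unchanged up to `t`, then reflected (`xₖ ↦ 2M+1-xₖ`) with a
one-step delay. [folklore] -/
theorem foldAt_apply_k {k : Fin d} {t : ℕ} {ω : ℕ → Site d} (i : ℕ) :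
    foldAt k t ω i k = if i ≤ t then ω i k else 2 * ω t k + 1 - ω (i - 1) k := by
  unfold foldAt
  split_ifs <;> simp

/-! ### Doubling a cut -/

/-- **Doubling the step `s → s+1`**: `ω 0, …, ω (s+1)`, then `ω (s+1) + eₖ, ω (s+2) + eₖ, …`.
[cite: MadrasSlade1993, §7.1] -/
def dblAt (k : Fin d) (s : ℕ) (ω : ℕ → Site d) : ℕ → Site d :=
  fun i => if i ≤ s + 1 then ω i else ω (i - 1) + Pi.single k 1

/-- Doubling keeps the walk up to and including the doubled step. [folklore] -/
theorem dblAt_of_le {k : Fin d} {s : ℕ} {ω : ℕ → Site d} {i : ℕ} (h : i ≤ s + 1) :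
    dblAt k s ω i = ω i := if_pos h

/-- After the doubled step the walk is translated by `eₖ` and delayed. [folklore] -/
theorem dblAt_of_lt {k : Fin d} {s : ℕ} {ω : ℕ → Site d} {i : ℕ} (h : s + 1 < i) :
    dblAt k s ω i = ω (i - 1) + Pi.single k 1 := if_neg (not_le.2 h)

/-- After the doubled step the walk is translated by `eₖ` and delayed. [folklore] -/
theorem dblAt_succ {k : Fin d} {s : ℕ} {ω : ℕ → Site d} {j : ℕ} (h : s + 1 ≤ j) :
    dblAt k s ω (j + 1) = ω j + Pi.single k 1 := by
  rw [dblAt_of_lt (Nat.lt_succ_of_le h)]; rfl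

/-- Doubling is injective on all vertex functions (the position being fixed). [folklore] -/
theorem dblAt_injective (k : Fin d) (s : ℕ) : Function.Injective (dblAt k s (d := d)) := by
  intro ω₁ ω₂ h
  funext j
  rcases Nat.lt_or_ge (s + 1) j with hj | hj
  · have := congrFun h (j + 1)
    rw [dblAt_succ hj.le, dblAt_succ hj.le] at this
    exact add_right_cancel this
  · have := congrFun h j
    rwa [dblAt_of_le hj, dblAt_of_le hj] at this

/-- **Doubling an up-cut of a self-avoiding walk gives a self-avoiding walk** (one step longer):
the past lies in `xₖ ≤ h`, the site `ω (s+1)` in `xₖ = h + 1`, the translated future in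
`xₖ ≥ h + 2`. [cite: MadrasSlade1993, §7.1] -/
theorem dblAt_mem_saws {k : Fin d} {n s : ℕ} {ω : ℕ → Site d} (hω : ω ∈ saws d n) (hs : s < n)
    (hstep : ω (s + 1) = ω s + Pi.single k 1) (hpast : ∀ i ≤ s, ω i k ≤ ω s k)
    (hfut : ∀ i, s + 1 ≤ i → i ≤ n → ω s k + 1 ≤ ω i k) : dblAt k s ω ∈ saws d (n + 1) := by
  obtain ⟨h0, hend, hadj, hinj⟩ := mem_saws.1 hω
  set h := ω s k with hh
  have hs1 : ω (s + 1) k = h + 1 := by rw [hstep]; simp [hh]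
  refine mem_saws.2 ⟨?_, ?_, ?_, ?_⟩
  · rw [dblAt_of_le (Nat.zero_le _), h0]
  · intro i hi
    rw [dblAt_of_lt (by omega), dblAt_of_lt (by omega), hend (i - 1) (by omega)]
    simp
  · intro i hi
    rcases lt_trichotomy i (s + 1) with hlt | rfl | hgt
    · rw [dblAt_of_le hlt.le, dblAt_of_le (by omega)]
      exact hadj i (by omega)
    · rw [dblAt_of_le le_rfl, dblAt_succ le_rfl]
      exact (zdGraph_adj_iff _ _).2 ⟨k, Or.inl rfl⟩
    · rw [dblAt_of_lt hgt, dblAt_succ hgt.le]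
      obtain ⟨j, rfl⟩ : ∃ j, i = j + 1 := ⟨i - 1, by omega⟩
      simp only [Nat.add_sub_cancel]
      exact (zdGraph_adj_add_right _ _ _).2 (hadj j (by omega))
  · have hlow : ∀ i ≤ s + 1, dblAt k s ω i k ≤ h + 1 := fun i hi => by
      rw [dblAt_of_le hi]
      rcases Nat.lt_or_ge i (s + 1) with h' | h'
      · have := hpast i (by omega); omega
      · have : i = s + 1 := by omega
        rw [this, hs1]
    have hhigh : ∀ i, s + 1 < i → i ≤ n + 1 → h + 2 ≤ dblAt k s ω i k := fun i hi hin => by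
      rw [dblAt_of_lt hi]
      have := hfut (i - 1) (by omega) (by omega)
      simp; omega
    intro i hi j hj hij
    simp only [Set.mem_setOf_eq] at hi hj
    rcases Nat.lt_or_ge (s + 1) i with his | his <;> rcases Nat.lt_or_ge (s + 1) j with hjs | hjs
    · rw [dblAt_of_lt his, dblAt_of_lt hjs] at hij
      have := hinj (by simp only [Set.mem_setOf_eq]; omega) (by simp only [Set.mem_setOf_eq]; omega)
        (add_right_cancel hij)
      omega
    · exfalso
      have h1 := hhigh i his hi; have h2 := hlow j hjs
      rw [hij] at h1; omega
    · exfalso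
      have h1 := hlow i his; have h2 := hhigh j hjs hj
      rw [hij] at h1; omega
    · rw [dblAt_of_le his, dblAt_of_le hjs] at hij
      exact hinj (by simp only [Set.mem_setOf_eq]; omega) (by simp only [Set.mem_setOf_eq]; omega) hij

/-- The `k`-profile of the doubled walk. [folklore] -/
theorem dblAt_apply_k {k : Fin d} {s : ℕ} {ω : ℕ → Site d} (i : ℕ) :
    dblAt k s ω i k = if i ≤ s + 1 then ω i k else ω (i - 1) k + 1 := by
  unfold dblAt
  split_ifs <;> simp

/-! ### The mirror image `-ω` -/

/-- The point reflection `ω ↦ -ω` preserves self-avoiding walks from `0`; it exchanges folds at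
maximal / minimal times and up- / down-cuts of the `k`-profile. [cite: MadrasSlade1993, §1.1] -/
theorem neg_mem_saws {n : ℕ} {ω : ℕ → Site d} (hω : ω ∈ saws d n) : (fun i => -ω i) ∈ saws d n := by
  obtain ⟨h0, hend, hadj, hinj⟩ := mem_saws.1 hω
  refine mem_saws.2 ⟨by simp [h0], fun i hi => by simp [hend i hi], fun i hi => ?_, ?_⟩
  · exact (zdGraph_adj_neg _ _).2 (hadj i hi)
  · intro i hi j hj hij
    exact hinj hi hj (neg_injective hij)

/-! ### From a profile-driven injective assignment to `cₙ ≤ cₙ₊₁` -/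

/-- **Lifting lemma.** If `Φ` maps `n`-step self-avoiding walks to `(n+1)`-step ones injectively,
then `cₙ ≤ cₙ₊₁`. (Bookkeeping: `#saws d n = cₙ`.) [cite: BDGS2012, §1.3] -/
theorem count_le_count_succ_of_injOn {n : ℕ} (Φ : (ℕ → Site d) → (ℕ → Site d))
    (hmaps : ∀ ω ∈ saws d n, Φ ω ∈ saws d (n + 1)) (hinj : Set.InjOn Φ (saws d n)) :
    count d n ≤ count d (n + 1) := by
  rw [← card_saws, ← card_saws]
  exact Finset.card_le_card_of_injOn Φ (fun ω hω => hmaps ω hω) hinj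

/-! ### Profile-driven operation choices and the lifting theorem -/

/-- The four profile-driven length-increasing operations: fold at a maximal / minimal time of the
`k`-profile, double an up- / down-cut of the `k`-profile. [cite: MadrasSlade1993, §7.1] -/
inductive OpChoice : Type
  | foldUp (t : ℕ)
  | foldDown (t : ℕ)
  | dblUp (s : ℕ)
  | dblDown (s : ℕ)
  deriving DecidableEq

/-- The operation on vertex functions (the "down" versions act on `-ω` and negate back).
[cite: MadrasSlade1993, §7.1] -/
def applyOp (k : Fin d) : OpChoice → (ℕ → Site d) → ℕ → Site d
  | .foldUp t, ω => foldAt k t ω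
  | .foldDown t, ω => fun i => -foldAt k t (fun j => -ω j) i
  | .dblUp s, ω => dblAt k s ω
  | .dblDown s, ω => fun i => -dblAt k s (fun j => -ω j) i

/-- Validity of an operation for a profile `π : ℕ → ℤ` on the time interval `[0, n]`: the folding
time is maximal (minimal), resp. the doubled step is an up- (down-) cut. [cite: MadrasSlade1993, §7.1] -/
def OpChoice.Valid : OpChoice → (ℕ → ℤ) → ℕ → Prop
  | .foldUp t, π, n => t ≤ n ∧ ∀ i ≤ n, π i ≤ π t
  | .foldDown t, π, n => t ≤ n ∧ ∀ i ≤ n, π t ≤ π i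
  | .dblUp s, π, n => s < n ∧ π (s + 1) = π s + 1 ∧ (∀ i ≤ s, π i ≤ π s) ∧
      ∀ i, s + 1 ≤ i → i ≤ n → π s + 1 ≤ π i
  | .dblDown s, π, n => s < n ∧ π (s + 1) = π s - 1 ∧ (∀ i ≤ s, π s ≤ π i) ∧
      ∀ i, s + 1 ≤ i → i ≤ n → π i ≤ π s - 1

/-- The effect of an operation on the profile. [cite: MadrasSlade1993, §7.1] -/
def OpChoice.profile : OpChoice → (ℕ → ℤ) → ℕ → ℤ
  | .foldUp t, π, i => if i ≤ t then π i else 2 * π t + 1 - π (i - 1)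
  | .foldDown t, π, i => if i ≤ t then π i else 2 * π t - 1 - π (i - 1)
  | .dblUp s, π, i => if i ≤ s + 1 then π i else π (i - 1) + 1
  | .dblDown s, π, i => if i ≤ s + 1 then π i else π (i - 1) - 1

/-- The `k`-profile of a vertex function. [folklore] -/
def kprof (k : Fin d) (ω : ℕ → Site d) : ℕ → ℤ := fun i => ω i k

/-- The operations act on the `k`-profile as prescribed by `OpChoice.profile`. [folklore] -/
theorem kprof_applyOp (k : Fin d) (c : OpChoice) (ω : ℕ → Site d) :
    kprof k (applyOp k c ω) = c.profile (kprof k ω) := by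
  funext i
  cases c with
  | foldUp t => simp only [kprof, applyOp, OpChoice.profile, foldAt_apply_k]
  | foldDown t =>
    simp only [kprof, applyOp, OpChoice.profile, Pi.neg_apply, foldAt_apply_k]
    split_ifs <;> ring
  | dblUp s => simp only [kprof, applyOp, OpChoice.profile, dblAt_apply_k]
  | dblDown s =>
    simp only [kprof, applyOp, OpChoice.profile, Pi.neg_apply, dblAt_apply_k]
    split_ifs <;> ring

/-- Each operation (with its position fixed) is injective on vertex functions. [folklore] -/
theorem applyOp_injective (k : Fin d) (c : OpChoice) : Function.Injective (applyOp k c (d := d)) := by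
  intro ω₁ ω₂ h
  cases c with
  | foldUp t => exact foldAt_injective k t h
  | foldDown t =>
    have h' : foldAt k t (fun j => -ω₁ j) = foldAt k t (fun j => -ω₂ j) := by
      funext i; have := congrFun h i; simp only [applyOp] at this; exact neg_injective this
    have := foldAt_injective k t h'
    funext j; exact neg_injective (congrFun this j)
  | dblUp s => exact dblAt_injective k s h
  | dblDown s =>
    have h' : dblAt k s (fun j => -ω₁ j) = dblAt k s (fun j => -ω₂ j) := by
      funext i; have := congrFun h i; simp only [applyOp] at this; exact neg_injective this
    have := dblAt_injective k s h'
    funext j; exact neg_injective (congrFun this j)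

/-- **A valid operation maps `n`-step self-avoiding walks to `(n+1)`-step ones.**
[cite: MadrasSlade1993, §7.1] -/
theorem applyOp_mem_saws {k : Fin d} {n : ℕ} {c : OpChoice} {ω : ℕ → Site d} (hω : ω ∈ saws d n)
    (hc : c.Valid (kprof k ω) n) : applyOp k c ω ∈ saws d (n + 1) := by
  cases c with
  | foldUp t =>
    obtain ⟨ht, hmax⟩ := hc
    exact foldAt_mem_saws hω ht hmax
  | foldDown t =>
    obtain ⟨ht, hmin⟩ := hc
    have h := foldAt_mem_saws (k := k) (neg_mem_saws hω) ht (fun i hi => by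
      simp only [Pi.neg_apply, neg_le_neg_iff]; exact hmin i hi)
    exact neg_mem_saws h
  | dblUp s =>
    obtain ⟨hs, hstep, hpast, hfut⟩ := hc
    have hadj := (mem_saws.1 hω).2.2.1 s hs
    exact dblAt_mem_saws hω hs (eq_add_single_of_adj hadj hstep) hpast hfut
  | dblDown s =>
    obtain ⟨hs, hstep, hpast, hfut⟩ := hc
    have hω' := neg_mem_saws hω
    have hadj := (mem_saws.1 hω').2.2.1 s hs
    have hstep' : (fun j => -ω j) (s + 1) k = (fun j => -ω j) s k + 1 := by
      simp only [Pi.neg_apply, kprof] at hstep ⊢; omega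
    have h := dblAt_mem_saws (k := k) hω' hs (eq_add_single_of_adj hadj hstep')
      (fun i hi => by simp only [Pi.neg_apply, neg_le_neg_iff]; exact hpast i hi)
      (fun i h1 h2 => by have := hfut i h1 h2; simp only [Pi.neg_apply, kprof] at this ⊢; omega)
    exact neg_mem_saws h

/-- **Lifting theorem.** Let `sel` choose, from the `k`-profile of a walk on `[0, n]`, one of the
four operations, validly; if the induced map on profiles is injective (equal image profiles on
`[0, n+1]` force equal profiles on `[0, n]`), then `cₙ ≤ cₙ₊₁`. This reduces O'Brien's
monotonicity theorem on `ℤ^d` (all `d ≥ 1`) to a statement about integer sequences.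
[cite: BDGS2012, §1.3] -/
theorem count_le_count_succ_of_selector (k : Fin d) {n : ℕ} (sel : (ℕ → ℤ) → OpChoice)
    (hdep : ∀ π₁ π₂ : ℕ → ℤ, (∀ i ≤ n, π₁ i = π₂ i) → sel π₁ = sel π₂)
    (hvalid : ∀ ω ∈ saws d n, (sel (kprof k ω)).Valid (kprof k ω) n)
    (hinj : ∀ ω₁ ∈ saws d n, ∀ ω₂ ∈ saws d n,
      (∀ i ≤ n + 1, (sel (kprof k ω₁)).profile (kprof k ω₁) i =
        (sel (kprof k ω₂)).profile (kprof k ω₂) i) → ∀ i ≤ n, kprof k ω₁ i = kprof k ω₂ i) :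
    count d n ≤ count d (n + 1) := by
  refine count_le_count_succ_of_injOn (fun ω => applyOp k (sel (kprof k ω)) ω)
    (fun ω hω => applyOp_mem_saws hω (hvalid ω hω)) ?_
  intro ω₁ h₁ ω₂ h₂ h
  simp only at h
  have hprof : ∀ i ≤ n + 1, (sel (kprof k ω₁)).profile (kprof k ω₁) i =
      (sel (kprof k ω₂)).profile (kprof k ω₂) i := fun i _ => by
    have := congrArg (fun ω => kprof k ω i) h
    simp only [kprof_applyOp] at this
    exact this
  have hsel : sel (kprof k ω₁) = sel (kprof k ω₂) := hdep _ _ (hinj ω₁ h₁ ω₂ h₂ hprof)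
  rw [hsel] at h
  exact applyOp_injective k _ h

end Literature.Probability.RandomPlanarGeometry.SAW.Zd
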